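import Summits.PneNP.PneNP.Theses.PhaseTwins

/-!
# `MacroscopicTwinsAbove` (stmt-PneNP-2720, route PneNP/PhaseTwins) — negative side III: the second degree bound is implied

Standing-adversary (cdisprove, cycle 2) lemma for `Summit.PneNP.PneNP.Theses.PhaseTwins.MacroscopicTwinsAbove`
(hypothesis mutation): the hypothesis `H.maxDegree ≤ Δ` of the crux is REDUNDANT. For `k ≥ 2`, homomorphism
indistinguishability over treewidth `< k` transports a degree bound from `G` to `H`:
* star counts `hom(K_{1,j}, ·)` lie between `(max deg)^j` (`pow_degree_le_card_hom_star`) and `n · (max deg)^j`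
  (`card_hom_star_le`); stars have treewidth `≤ 1` (`treewidth_star_le`, bags `{0, t}` along a path);
  and `n Δ^j < (Δ+1)^j` at `j = nΔ + 1` (`numeric_star`, Bernoulli); hence `maxDegree_le_of_homIndist`.
* `not_macroscopicTwinsAbove_iff_not_withoutDegH`: refuting the crux is the same as refuting the form that bounds only
  `G`'s degree (at depth `max k 2` the bound on `H` follows; the depth is antitone). Not a load-bearing hypothesis —
  a refuter may drop it, a prover need only certify one degree bound.
Self-contained (imports the route file only). Refuter seat cdisprove-stmt-PneNP-2720-g2, 2026-08-16; commentary in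
`Summits/PneNP/PneNP/Cruxes/MacroscopicTwinsAbove/Disproof.lean` §(a′).
-/

set_option linter.dupNamespace false

namespace Summit.PneNP.PneNP.Theorems.MacroscopicTwinsAbove.Negative

open scoped Classical BigOperators
open Finset Literature.Combinatorics.SimpleGraph

/-- The star `K_{1,j}` on `Fin (j+1)` with centre `0`. -/
def star (j : ℕ) : SimpleGraph (Fin (j + 1)) :=
  SimpleGraph.fromRel fun a _ => a = 0

/-- Adjacency in the star: distinct vertices one of which is the centre. [folklore] -/
theorem star_adj {j : ℕ} (a b : Fin (j + 1)) : (star j).Adj a b ↔ a ≠ b ∧ (a = 0 ∨ b = 0) := by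
  simp [star, SimpleGraph.fromRel_adj]

/-- The centre is adjacent to every leaf. [folklore] -/
theorem star_adj_zero_succ {j : ℕ} (i : Fin j) : (star j).Adj 0 i.succ := by
  rw [star_adj]
  exact ⟨(Fin.succ_ne_zero i).symm, Or.inl rfl⟩

/-- Stars have treewidth `≤ 1` (bags `{0, t}` along a path). [folklore] -/
theorem treewidth_star_le (j : ℕ) : treewidth (star j) ≤ 1 := by
  refine treewidth_le_of_intervals (star j)
    (fun t : Fin (j + 1) => ({0, t} : Finset (Fin (j + 1)))) ?_ ?_ ?_ ?_
  · intro u v huv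
    rw [star_adj] at huv
    rcases huv.2 with h | h
    · exact ⟨v, by simp [h]⟩
    · exact ⟨u, by simp [h]⟩
  · intro v
    exact ⟨v, by simp⟩
  · intro v
    by_cases hv : v = 0
    · subst hv
      have : {t : Fin (j + 1) | (0 : Fin (j + 1)) ∈ ({0, t} : Finset (Fin (j + 1)))} = Set.univ := by
        ext t; simp
      rw [this]
      exact Set.ordConnected_univ
    · have : {t : Fin (j + 1) | v ∈ ({0, t} : Finset (Fin (j + 1)))} = {v} := by
        ext t
        simp only [Finset.mem_insert, Finset.mem_singleton, Set.mem_setOf_eq, Set.mem_singleton_iff, hv,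
          false_or]
        exact eq_comm
      rw [this]
      exact Set.ordConnected_singleton
  · intro t
    exact (Finset.card_insert_le _ _).trans (by simp)

/-- Lower bound on star counts: a vertex of degree `d` gives `d^j` homomorphisms `K_{1,j} → H`. [folklore] -/
theorem pow_degree_le_card_hom_star {n : ℕ} (j : ℕ) (H : SimpleGraph (Fin n)) (w : Fin n) :
    H.degree w ^ j ≤ Nat.card (star j →g H) := by
  haveI : Finite (star j →g H) :=
    Finite.of_injective (fun φ : star j →g H => (φ : Fin (j + 1) → Fin n)) DFunLike.coe_injective
  let φ : (Fin j → H.neighborSet w) → (star j →g H) := fun f =>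
    { toFun := fun a => if h : a = 0 then w else (f (a.pred h)).1
      map_rel' := by
        intro a b hab
        rw [star_adj] at hab
        obtain ⟨hne, h0 | h0⟩ := hab
        · subst h0
          have hb : b ≠ 0 := fun hb => hne hb.symm
          simp only [dif_pos, dif_neg hb]
          exact (f (b.pred hb)).2
        · subst h0
          simp only [dif_pos, dif_neg hne]
          exact ((f (a.pred hne)).2).symm }
  have hinj : Function.Injective φ := by
    intro f g hfg
    funext i
    have h := congrArg (fun ψ : star j →g H => ψ i.succ) hfg
    simp only [φ, RelHom.coeFn_mk, dif_neg (Fin.succ_ne_zero i), Fin.pred_succ] at h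
    exact Subtype.ext h
  have h1 := Nat.card_le_card_of_injective φ hinj
  have h2 : Nat.card (Fin j → H.neighborSet w) = H.degree w ^ j := by
    rw [Nat.card_fun, Nat.card_eq_fintype_card, Nat.card_eq_fintype_card, Fintype.card_fin,
      SimpleGraph.card_neighborSet_eq_degree]
  rw [h2] at h1
  exact h1

/-- Upper bound on star counts: with maximum degree `≤ Δ` there are at most `n·Δ^j` homomorphisms `K_{1,j} → G`
(a homomorphism is the image of the centre plus `j` of its neighbours). [folklore] -/
theorem card_hom_star_le {n : ℕ} (j : ℕ) (G : SimpleGraph (Fin n)) {Δ : ℕ} (hG : G.maxDegree ≤ Δ) :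
    Nat.card (star j →g G) ≤ n * Δ ^ j := by
  let ψ : (star j →g G) → Σ v : Fin n, (Fin j → G.neighborSet v) := fun φ =>
    ⟨φ 0, fun i => ⟨φ i.succ, φ.map_rel (star_adj_zero_succ i)⟩⟩
  have hinj : Function.Injective ψ := by
    intro φ₁ φ₂ h
    simp only [ψ, Sigma.mk.injEq] at h
    obtain ⟨h0, hs⟩ := h
    apply RelHom.ext
    intro a
    refine Fin.cases ?_ (fun i => ?_) a
    · exact h0
    · have key : ∀ (v₁ v₂ : Fin n) (_ : v₁ = v₂) (f₁ : Fin j → G.neighborSet v₁)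
          (f₂ : Fin j → G.neighborSet v₂), HEq f₁ f₂ → ∀ i, (f₁ i).1 = (f₂ i).1 := by
        intro v₁ v₂ hv f₁ f₂ hf i
        subst hv
        rw [heq_iff_eq] at hf
        rw [hf]
      exact key _ _ h0 _ _ hs i
  have h1 := Nat.card_le_card_of_injective ψ hinj
  have h2 : Nat.card (Σ v : Fin n, (Fin j → G.neighborSet v)) = ∑ v : Fin n, G.degree v ^ j := by
    rw [Nat.card_eq_fintype_card, Fintype.card_sigma]
    refine Finset.sum_congr rfl fun v _ => ?_
    rw [Fintype.card_fun, Fintype.card_fin, SimpleGraph.card_neighborSet_eq_degree]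
  rw [h2] at h1
  refine h1.trans ?_
  calc ∑ v : Fin n, G.degree v ^ j ≤ ∑ _v : Fin n, Δ ^ j :=
        Finset.sum_le_sum fun v _ => Nat.pow_le_pow_left ((G.degree_le_maxDegree v).trans hG) j
    _ = n * Δ ^ j := by simp

/-- Bernoulli in `ℕ`: `Δ^{j+1} + (j+1)·Δ^j ≤ (Δ+1)^{j+1}`. [folklore] -/
theorem bernoulli_nat (Δ j : ℕ) : Δ ^ (j + 1) + (j + 1) * Δ ^ j ≤ (Δ + 1) ^ (j + 1) := by
  induction j with
  | zero => simp
  | succ j ih =>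
    have h1 : (Δ + 1) ^ (j + 2) = (Δ + 1) ^ (j + 1) * (Δ + 1) := pow_succ _ _
    have h2 : (Δ ^ (j + 1) + (j + 1) * Δ ^ j) * (Δ + 1) ≤ (Δ + 1) ^ (j + 1) * (Δ + 1) :=
      Nat.mul_le_mul_right _ ih
    have h3 : Δ ^ (j + 2) + (j + 2) * Δ ^ (j + 1) ≤ (Δ ^ (j + 1) + (j + 1) * Δ ^ j) * (Δ + 1) := by
      have : Δ ^ (j + 2) = Δ ^ (j + 1) * Δ := pow_succ _ _
      have : Δ ^ (j + 1) = Δ ^ j * Δ := pow_succ _ _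
      nlinarith [Nat.zero_le (Δ ^ j), Nat.zero_le (j * Δ ^ j)]
    calc Δ ^ (j + 2) + (j + 2) * Δ ^ (j + 1) ≤ (Δ ^ (j + 1) + (j + 1) * Δ ^ j) * (Δ + 1) := h3
      _ ≤ (Δ + 1) ^ (j + 1) * (Δ + 1) := h2
      _ = (Δ + 1) ^ (j + 2) := h1.symm

/-- The numeric fact behind the star argument: `n·Δ^{nΔ+1} < (Δ+1)^{nΔ+1}`. [folklore] -/
theorem numeric_star (n Δ : ℕ) : n * Δ ^ (n * Δ + 1) < (Δ + 1) ^ (n * Δ + 1) := by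
  have h := bernoulli_nat Δ (n * Δ)
  have hpos : 1 ≤ Δ ^ (n * Δ) := by
    rcases Nat.eq_zero_or_pos Δ with rfl | hΔ
    · simp
    · exact Nat.one_le_pow _ _ hΔ
  have h2 : (n * Δ + 1) * Δ ^ (n * Δ) = n * Δ ^ (n * Δ + 1) + Δ ^ (n * Δ) := by ring
  omega

/-- **The second degree bound is implied.** If `G` and `H` on `Fin n` are hom-indistinguishable over treewidth
`< k` with `k ≥ 2` and `G.maxDegree ≤ Δ`, then `H.maxDegree ≤ Δ`: otherwise a vertex of `H` of degree `≥ Δ+1`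
gives `(Δ+1)^j ≤ hom(K_{1,j}, H) = hom(K_{1,j}, G) ≤ n Δ^j`, impossible at `j = nΔ + 1`. [folklore] -/
theorem maxDegree_le_of_homIndist {n k Δ : ℕ} {G H : SimpleGraph (Fin n)} (hk : 2 ≤ k)
    (hhom : ∀ (m : ℕ) (F : SimpleGraph (Fin m)), treewidth F < k → Nat.card (F →g G) = Nat.card (F →g H))
    (hG : G.maxDegree ≤ Δ) : H.maxDegree ≤ Δ := by
  by_contra hH
  have hH' : Δ < H.maxDegree := not_le.1 hH
  rcases Nat.eq_zero_or_pos n with rfl | hn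
  · have : H.maxDegree = 0 := by
      simp [SimpleGraph.maxDegree, Finset.univ_eq_empty]
    omega
  · haveI : Nonempty (Fin n) := ⟨⟨0, hn⟩⟩
    obtain ⟨w, hw⟩ := H.exists_maximal_degree_vertex
    have h1 : (Δ + 1) ^ (n * Δ + 1) ≤ Nat.card (star (n * Δ + 1) →g H) :=
      (Nat.pow_le_pow_left (by omega) _).trans (pow_degree_le_card_hom_star (n * Δ + 1) H w)
    have h2 : Nat.card (star (n * Δ + 1) →g G) ≤ n * Δ ^ (n * Δ + 1) :=
      card_hom_star_le (n * Δ + 1) G hG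
    have h3 : Nat.card (star (n * Δ + 1) →g G) = Nat.card (star (n * Δ + 1) →g H) :=
      hhom _ (star (n * Δ + 1)) (lt_of_le_of_lt (treewidth_star_le _) (lt_of_lt_of_le one_lt_two hk))
    have h4 := numeric_star n Δ
    omega

/-- **`H.maxDegree ≤ Δ` is a redundant hypothesis of the crux.** Refuting `MacroscopicTwinsAbove` is the same as
refuting the variant that bounds only `G`'s degree: at depth `max k 2` the bound on `H` follows from
`maxDegree_le_of_homIndist`, and hom-indistinguishability is antitone in the depth (depths `k ≤ 1` are trivial
either way). So a refuter may drop the hypothesis and a prover need only certify one degree bound. [folklore] -/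
theorem not_macroscopicTwinsAbove_iff_not_withoutDegH :
    ¬ Summit.PneNP.PneNP.Theses.PhaseTwins.MacroscopicTwinsAbove ↔
      ¬ ∀ Δ : ℕ, 3 ≤ Δ → ∀ lam : ℝ, ((Δ : ℝ) - 1) ^ (Δ - 1) / ((Δ : ℝ) - 2) ^ Δ < lam → ∃ δ : ℝ, 0 < δ ∧
        ∀ k : ℕ, ∃ (n : ℕ) (G H : SimpleGraph (Fin n)), 0 < n ∧ G.maxDegree ≤ Δ ∧
          (∀ (m : ℕ) (F : SimpleGraph (Fin m)), treewidth F < k → Nat.card (F →g G) = Nat.card (F →g H)) ∧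
          Real.exp (δ * n) * (∑ I : Finset (Fin n), (if H.IsIndepSet (↑I : Set (Fin n)) then lam ^ I.card else 0)) ≤
            ∑ I : Finset (Fin n), (if G.IsIndepSet (↑I : Set (Fin n)) then lam ^ I.card else 0) := by
  rw [not_iff_not]
  constructor
  · intro h Δ hΔ lam hlam
    obtain ⟨δ, hδ, hk⟩ := h Δ hΔ lam hlam
    refine ⟨δ, hδ, fun k => ?_⟩
    obtain ⟨n, G, H, hn, hG, -, hhom, hgap⟩ := hk k
    exact ⟨n, G, H, hn, hG, hhom, hgap⟩
  · intro h Δ hΔ lam hlam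
    obtain ⟨δ, hδ, hk⟩ := h Δ hΔ lam hlam
    refine ⟨δ, hδ, fun k => ?_⟩
    obtain ⟨n, G, H, hn, hG, hhom, hgap⟩ := hk (max k 2)
    have hhom' : ∀ (m : ℕ) (F : SimpleGraph (Fin m)), treewidth F < k →
        Nat.card (F →g G) = Nat.card (F →g H) :=
      fun m F hF => hhom m F (lt_of_lt_of_le hF (le_max_left _ _))
    exact ⟨n, G, H, hn, hG, maxDegree_le_of_homIndist (le_max_right k 2) hhom hG, hhom', hgap⟩

end Summit.PneNP.PneNP.Theorems.MacroscopicTwinsAbove.Negative
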